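import Literature.Analysis.Complex.CauchyPompeiu
import Mathlib.Analysis.Calculus.ContDiff.Operations
import Mathlib.Analysis.Calculus.FDeriv.Mul

/-!
# The normal coordinate of a linearised `J`-holomorphic field satisfies `‖∂̄ σ‖ ≤ M ‖σ‖`
(registered helper `helper_linearisedDbarBound` of line `cross-cap-laurent`, crux `GromovRecognitionRelEnd`,
item stmt-SmoothPoincare4-11009; second brick of the flat proof of the child stub
`stub_normalVelocityDichotomy` of the split piece `LocalFoliationEmbeddedSpheres`, item
stmt-SmoothPoincare4-16778)

Flat model (`F` a real normed space, `J : F → End(F)` and `b : ℂ → F` smooth).  Along the curve `b` we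
are given, on a disc `ball 0 ρ`, the tangential/normal coordinates `Q_z, P_z : F →L[ℝ] ℂ` of the
previous brick (`helper_linearisedNormalFrame`): `v = db_z (Q_z v) + Re (P_z v) • ν₀ + Im (P_z v) • J(b z) ν₀`,
`P_z (J(b z) v) = i P_z v`, `P_z ∘ db_z = 0`, `z ↦ P_z` smooth.  A field `ξ : ℂ → F` along `b` is a
solution of the LINEARISED Cauchy–Riemann equation if

  `Dξ_z(iζ) = J(b z) (Dξ_z ζ) + (DJ(b z)[ξ z]) (db_z ζ)`       (★)

(the `a`-derivative of a smooth family of `J`-holomorphic curves through `b` is such a field — tree: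
`helper_linearisedCRFamily`; so are the tangential fields `z ↦ db_z w`, hypothesis `htan`).

Claim (`helper_linearisedDbarBound`; Wendl 2018 §2.4–2.5 / Wendl 2010 §3.3: "the normal projection
of the linearised operator is a real-linear Cauchy–Riemann type operator on the normal bundle"): the
normal coordinate `σ z = P_z (ξ z)` satisfies `‖∂̄ σ‖ ≤ M ‖σ‖` on a smaller closed disc.  Proof
(`LinearisedDbar.dbar_eq`): by the product rule and (★), using `P_z J = i P_z`,
`2 ∂̄ σ(z) = Λ_z (ξ z)` with the pointwise real-linear
`Λ_z v = (∂ₓP_z) v + i (∂_yP_z) v + i P_z ((DJ(b z) v)(∂ₓ b z))` — the term `P_z (∂ₓ ξ)` cancels.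
Applied to the tangential solutions `db_z w`, whose normal coordinate vanishes identically, this gives
`Λ_z (db_z w) = 0` (`LinearisedDbar.lambda_tangent`); hence `Λ_z (ξ z) = Λ_z (ι_z (σ z))` with the
normal frame `ι_z β = Re β • ν₀ + Im β • J(b z) ν₀`, and `‖∂̄ σ‖ ≤ ½ ‖Λ_z‖ ‖ι_z‖ ‖σ‖`, the operator norms
being bounded on a compact disc by continuity.

References: C. Wendl, *Holomorphic Curves in Low Dimensions*, LNM 2216 (2018), §2.4–2.5 (the normal
Cauchy–Riemann operator, Prop. 2.47); C. Wendl, *Automatic transversality and orbifolds of punctured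
holomorphic curves in dimension four*, Comment. Math. Helv. 85 (2010), §3.3.  No new definitions,
notation or instances.
-/

noncomputable section

open scoped ContDiff Topology
open Set Function Filter Metric Literature.Analysis.Complex

-- the prescribed namespace `Summit.<P>.<Sub>.…` duplicates `SmoothPoincare4` (P = Sub)
set_option linter.dupNamespace false

namespace Summit.SmoothPoincare4.SmoothPoincare4.Theorems.GromovRecognitionRelEnd.CrossCapLaurent

namespace LinearisedDbar

variable {F : Type*} [NormedAddCommGroup F] [NormedSpace ℝ F]

/-- In one complex variable `∂̄ f (z) = ½ (Df(z) 1 + i Df(z) i)`. [folklore] -/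
theorem dbarAlong_one_eq (f : ℂ → ℂ) (z : ℂ) :
    dbarAlong 1 f z = (2 : ℂ)⁻¹ * (fderiv ℝ f z 1 + Complex.I * fderiv ℝ f z Complex.I) := by
  rw [dbarAlong_apply, smul_eq_mul, smul_eq_mul, smul_eq_mul, mul_one]

/-- **The `∂̄`-identity for the normal coordinate of a linearised field.**  If `η` is differentiable
at `z`, satisfies the linearised equation (★) at `z`, `P` is differentiable at `z` and `P z` is
complex linear for `J(b z)`, then
`2 ∂̄ (P · (η ·))(z) = (DP_z 1)(η z) + i (DP_z i)(η z) + i P_z ((DJ(b z)(η z)) (db_z 1))`.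
[cite: Wendl2018, §2.4–2.5] -/
theorem dbar_eq {J : F → F →L[ℝ] F} {b : ℂ → F} {P : ℂ → F →L[ℝ] ℂ} {η : ℂ → F} {z : ℂ}
    (hP : DifferentiableAt ℝ P z) (hη : DifferentiableAt ℝ η z)
    (hPJ : ∀ v : F, P z (J (b z) v) = Complex.I * P z v)
    (hlin : ∀ ζ : ℂ, fderiv ℝ η z (Complex.I * ζ) =
      J (b z) (fderiv ℝ η z ζ) + (fderiv ℝ J (b z) (η z)) (fderiv ℝ b z ζ)) :
    2 * dbarAlong 1 (fun z => P z (η z)) z =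
      (fderiv ℝ P z 1) (η z) + Complex.I * (fderiv ℝ P z Complex.I) (η z) +
        Complex.I * P z ((fderiv ℝ J (b z) (η z)) (fderiv ℝ b z 1)) := by
  have hprod : ∀ h : ℂ, fderiv ℝ (fun z => P z (η z)) z h =
      (fderiv ℝ P z h) (η z) + P z (fderiv ℝ η z h) := fun h => by
    rw [fderiv_clm_apply hP hη]
    simp only [add_apply, ContinuousLinearMap.coe_comp, comp_apply,
      ContinuousLinearMap.flip_apply]
    ring
  have hI : fderiv ℝ η z Complex.I =
      J (b z) (fderiv ℝ η z 1) + (fderiv ℝ J (b z) (η z)) (fderiv ℝ b z 1) := by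
    have := hlin 1
    rwa [mul_one] at this
  rw [dbarAlong_one_eq, hprod, hprod, hI, map_add, hPJ, ← mul_assoc, mul_inv_cancel₀ two_ne_zero,
    one_mul]
  linear_combination (P z (fderiv ℝ η z 1)) * Complex.I_sq

/-- **The tangential solutions have vanishing `Λ`.**  If the normal coordinate of the field
`η z = db_z w` vanishes identically near `z` (it does: `P_z ∘ db_z = 0`) and `η` satisfies (★) at `z`,
then `(DP_z 1)(db_z w) + i (DP_z i)(db_z w) + i P_z ((DJ(b z)(db_z w)) (db_z 1)) = 0`. [folklore] -/
theorem lambda_tangent {J : F → F →L[ℝ] F} {b : ℂ → F} {P : ℂ → F →L[ℝ] ℂ} {z : ℂ} {w : ℂ}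
    (hP : DifferentiableAt ℝ P z) (hb : DifferentiableAt ℝ (fun z => fderiv ℝ b z w) z)
    (hPJ : ∀ v : F, P z (J (b z) v) = Complex.I * P z v)
    (hzero : ∀ᶠ y in 𝓝 z, P y (fderiv ℝ b y w) = 0)
    (hlin : ∀ ζ : ℂ, fderiv ℝ (fun z => fderiv ℝ b z w) z (Complex.I * ζ) =
      J (b z) (fderiv ℝ (fun z => fderiv ℝ b z w) z ζ) +
        (fderiv ℝ J (b z) (fderiv ℝ b z w)) (fderiv ℝ b z ζ)) :
    (fderiv ℝ P z 1) (fderiv ℝ b z w) + Complex.I * (fderiv ℝ P z Complex.I) (fderiv ℝ b z w) +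
        Complex.I * P z ((fderiv ℝ J (b z) (fderiv ℝ b z w)) (fderiv ℝ b z 1)) = 0 := by
  have key := dbar_eq (η := fun z => fderiv ℝ b z w) hP hb hPJ hlin
  have hd : dbarAlong 1 (fun y => P y (fderiv ℝ b y w)) z = 0 := by
    have hf : fderiv ℝ (fun y => P y (fderiv ℝ b y w)) z = 0 := by
      rw [Filter.EventuallyEq.fderiv_eq (hzero.mono fun y hy => hy)]
      exact fderiv_const_apply 0
    rw [dbarAlong_one_eq, hf]
    simp
  rw [hd, mul_zero] at key
  exact key.symm

/-- The normal frame `ι_z β = Re β • ν₀ + Im β • J(b z) ν₀` as a real-linear map `ℂ →L[ℝ] F`, with its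
evaluation. [folklore] -/
theorem normalFrame_apply (ν₀ V : F) (β : ℂ) :
    (Complex.reCLM.smulRight ν₀ + Complex.imCLM.smulRight V) β = β.re • ν₀ + β.im • V := by
  simp

end LinearisedDbar

open LinearisedDbar in
/-- **Registered helper `helper_linearisedDbarBound`: the normal coordinate of a solution of the
linearised Cauchy–Riemann equation along an immersed `J`-curve satisfies `‖∂̄ σ‖ ≤ M ‖σ‖` near the
point.**  Data: the frame package of `helper_linearisedNormalFrame` on `ball 0 ρ` (decomposition,
complex linearity of `P`, `P ∘ db = 0`, smoothness of `P`), the linearised equation for the tangential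
fields `z ↦ db_z w` and for the smooth field `ξ` on that disc.  Conclusion: radii `0 < ρ'`, `2ρ' < ρ`,
a constant `M ≥ 0`, smoothness of `σ = P (ξ)` on `ball 0 (2ρ')` and `‖∂̄ σ z‖ ≤ M ‖σ z‖` for
`‖z‖ ≤ ρ'` (the input of the local similarity principle). [cite: Wendl2018, §2.4–2.5] -/
theorem helper_linearisedDbarBound : ∀ (F : Type) [NormedAddCommGroup F] [NormedSpace ℝ F] (J : F → F →L[ℝ] F) (b : ℂ → F) (ν₀ : F) (ρ : ℝ) (P Q : ℂ → F →L[ℝ] ℂ) (ξ : ℂ → F), ContDiff ℝ ∞ J → ContDiff ℝ ∞ b → 0 < ρ → ContDiffOn ℝ ∞ P (Metric.ball 0 ρ) → (∀ z ∈ Metric.ball (0 : ℂ) ρ, (∀ v : F, v = fderiv ℝ b z (Q z v) + ((P z v).re • ν₀ + (P z v).im • J (b z) ν₀)) ∧ (∀ v : F, P z (J (b z) v) = Complex.I * P z v) ∧ (∀ w : ℂ, P z (fderiv ℝ b z w) = 0)) → (∀ z ∈ Metric.ball (0 : ℂ) ρ, ∀ w ζ : ℂ, fderiv ℝ (fun z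 : ℂ => fderiv ℝ b z w) z (Complex.I * ζ) = J (b z) (fderiv ℝ (fun z : ℂ => fderiv ℝ b z w) z ζ) + (fderiv ℝ J (b z) (fderiv ℝ b z w)) (fderiv ℝ b z ζ)) → ContDiffOn ℝ ∞ ξ (Metric.ball 0 ρ) → (∀ z ∈ Metric.ball (0 : ℂ) ρ, ∀ ζ : ℂ, fderiv ℝ ξ z (Complex.I * ζ) = J (b z) (fderiv ℝ ξ z ζ) + (fderiv ℝ J (b z) (ξ z)) (fderiv ℝ b z ζ)) → ∃ ρ' M : ℝ, 0 < ρ' ∧ 2 * ρ' < ρ ∧ 0 ≤ M ∧ ContDiffOn ℝ ∞ (fun z : ℂ => P z (ξ z)) (Metric.ball 0 (2 * ρ')) ∧ ∀ z ∈ Metric.closedBall (0 : ℂ) ρ', ‖Literature.Analysis.Complex.dbarAlong 1 (fun z : ℂ => P z (ξ z)) z‖ ≤ M * ‖P z (ξ z)‖ := by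
  intro F _ _ J b ν₀ ρ P Q ξ hJ hb hρ hP hpack htan hξ hlin
  -- radii
  set ρ' : ℝ := ρ / 3 with hρ'_def
  have hρ' : 0 < ρ' := by positivity
  have h2ρ' : 2 * ρ' < ρ := by rw [hρ'_def]; linarith
  have hcb : closedBall (0 : ℂ) ρ' ⊆ ball 0 ρ := closedBall_subset_ball (by rw [hρ'_def]; linarith)
  have hbb : ball (0 : ℂ) (2 * ρ') ⊆ ball 0 ρ := ball_subset_ball h2ρ'.le
  -- the operator `Λ_z` and the normal frame `ι_z` as continuous functions of `z` on the disc
  set Λ : ℂ → F →L[ℝ] ℂ := fun z => fderiv ℝ P z 1 + Complex.I • fderiv ℝ P z Complex.I +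
    Complex.I • ((P z).comp ((ContinuousLinearMap.apply ℝ F (fderiv ℝ b z 1)).comp
      (fderiv ℝ J (b z)))) with hΛ_def
  set ι : ℂ → ℂ →L[ℝ] F := fun z => Complex.reCLM.smulRight ν₀ + Complex.imCLM.smulRight (J (b z) ν₀)
    with hι_def
  have hΛapply : ∀ z v, Λ z v = (fderiv ℝ P z 1) v + Complex.I * (fderiv ℝ P z Complex.I) v +
      Complex.I * P z ((fderiv ℝ J (b z) v) (fderiv ℝ b z 1)) := fun z v => by
    simp only [hΛ_def, add_apply, smul_apply,
      ContinuousLinearMap.coe_comp, comp_apply, ContinuousLinearMap.apply_apply, smul_eq_mul]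
  have hιapply : ∀ z β, ι z β = β.re • ν₀ + β.im • J (b z) ν₀ := fun z β => by
    simp only [hι_def]
    exact normalFrame_apply ν₀ (J (b z) ν₀) β
  -- continuity of `Λ` and `ι` on the open disc
  have hPc : ContinuousOn (fun z => fderiv ℝ P z) (ball 0 ρ) :=
    hP.continuousOn_fderiv_of_isOpen isOpen_ball (by simp)
  have hΛc : ContinuousOn Λ (ball 0 ρ) := by
    have h1 : ContinuousOn (fun z => fderiv ℝ P z 1) (ball 0 ρ) :=
      hPc.clm_apply continuousOn_const
    have h2' : ContinuousOn (fun z => fderiv ℝ P z Complex.I) (ball 0 ρ) :=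
      hPc.clm_apply continuousOn_const
    have h2 : ContinuousOn (fun z => Complex.I • fderiv ℝ P z Complex.I) (ball 0 ρ) :=
      h2'.const_smul Complex.I
    have hbd : Continuous (fun z => fderiv ℝ b z 1) :=
      (hb.continuous_fderiv (by simp)).clm_apply continuous_const
    have hap : Continuous (fun z => ContinuousLinearMap.apply ℝ F (fderiv ℝ b z 1)) :=
      (ContinuousLinearMap.apply ℝ F).continuous.comp hbd
    have hJd : Continuous (fun z => fderiv ℝ J (b z)) :=
      (hJ.continuous_fderiv (by simp)).comp hb.continuous
    have h3' : ContinuousOn (fun z => (P z).comp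
        ((ContinuousLinearMap.apply ℝ F (fderiv ℝ b z 1)).comp (fderiv ℝ J (b z)))) (ball 0 ρ) :=
      hP.continuousOn.clm_comp ((hap.clm_comp hJd).continuousOn)
    have h3 : ContinuousOn (fun z => Complex.I • ((P z).comp
        ((ContinuousLinearMap.apply ℝ F (fderiv ℝ b z 1)).comp (fderiv ℝ J (b z))))) (ball 0 ρ) :=
      h3'.const_smul Complex.I
    exact (h1.add h2).add h3
  have hιc : Continuous ι := by
    have hv : ContDiff ℝ ∞ (fun z => J (b z) ν₀) := (hJ.comp hb).clm_apply contDiff_const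
    have hι' : ContDiff ℝ ∞ ι := contDiff_const.add (contDiff_const.smulRight hv)
    exact hι'.continuous
  -- uniform bounds on the compact disc
  obtain ⟨CΛ, hCΛ⟩ := (isCompact_closedBall (0 : ℂ) ρ').exists_bound_of_continuousOn (hΛc.mono hcb)
  obtain ⟨Cι, hCι⟩ := (isCompact_closedBall (0 : ℂ) ρ').exists_bound_of_continuousOn
    (hιc.continuousOn (s := closedBall 0 ρ'))
  have hCΛ0 : 0 ≤ CΛ := (norm_nonneg _).trans (hCΛ 0 (mem_closedBall_self hρ'.le))
  have hCι0 : 0 ≤ Cι := (norm_nonneg _).trans (hCι 0 (mem_closedBall_self hρ'.le))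
  refine ⟨ρ', 2⁻¹ * CΛ * Cι, hρ', h2ρ', by positivity, ?_, fun z hz => ?_⟩
  · exact (hP.mono hbb).clm_apply (hξ.mono hbb)
  -- the pointwise inequality at `z ∈ closedBall 0 ρ'`
  have hzρ : z ∈ ball (0 : ℂ) ρ := hcb hz
  obtain ⟨hdec, hPJ, hPb⟩ := hpack z hzρ
  have hPz : DifferentiableAt ℝ P z :=
    (hP.contDiffAt (isOpen_ball.mem_nhds hzρ)).differentiableAt (by simp)
  have hξz : DifferentiableAt ℝ ξ z :=
    (hξ.contDiffAt (isOpen_ball.mem_nhds hzρ)).differentiableAt (by simp)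
  -- `2 ∂̄ σ = Λ_z (ξ z)`
  have key := dbar_eq hPz hξz hPJ (hlin z hzρ)
  rw [← hΛapply] at key
  -- `Λ_z` kills the tangent line
  have htan0 : ∀ w : ℂ, Λ z (fderiv ℝ b z w) = 0 := by
    intro w
    rw [hΛapply]
    have hbw : DifferentiableAt ℝ (fun z => fderiv ℝ b z w) z :=
      ((hb.fderiv_right (m := ∞) (by simp)).clm_apply contDiff_const).differentiable (by simp) z
    have hzero : ∀ᶠ y in 𝓝 z, P y (fderiv ℝ b y w) = 0 := by
      filter_upwards [isOpen_ball.mem_nhds hzρ] with y hy using (hpack y hy).2.2 w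
    exact lambda_tangent hPz hbw hPJ hzero (htan z hzρ w)
  -- hence `Λ_z (ξ z) = Λ_z (ι_z σ)`
  have hΛξ : Λ z (ξ z) = Λ z (ι z (P z (ξ z))) := by
    conv_lhs => rw [hdec (ξ z)]
    rw [map_add, htan0, zero_add, hιapply]
  rw [hΛξ] at key
  -- norms
  have h2 : dbarAlong 1 (fun z => P z (ξ z)) z = (2 : ℂ)⁻¹ * Λ z (ι z (P z (ξ z))) := by
    rw [← key, ← mul_assoc, inv_mul_cancel₀ two_ne_zero, one_mul]
  rw [h2, norm_mul, norm_inv, Complex.norm_two]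
  calc 2⁻¹ * ‖Λ z (ι z (P z (ξ z)))‖ ≤ 2⁻¹ * (‖Λ z‖ * (‖ι z‖ * ‖P z (ξ z)‖)) := by
        gcongr
        exact (ContinuousLinearMap.le_opNorm _ _).trans
          (mul_le_mul_of_nonneg_left (ContinuousLinearMap.le_opNorm _ _) (norm_nonneg _))
    _ ≤ 2⁻¹ * (CΛ * (Cι * ‖P z (ξ z)‖)) := by
        gcongr
        · exact hCΛ z hz
        · exact hCι z hz
    _ = 2⁻¹ * CΛ * Cι * ‖P z (ξ z)‖ := by ring

end Summit.SmoothPoincare4.SmoothPoincare4.Theorems.GromovRecognitionRelEnd.CrossCapLaurent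

end
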